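import Summits.ResolutionOfSingularities.ResolutionOfSingularities.Theorems.EquisingularLiftEquisingularLiftNatProportionalCocycle
import Literature.AlgebraicGeometry.Resolution.SpreadRestrict
import Literature.AlgebraicGeometry.Modules.LineBundleOfCocycleClass
import Literature.AlgebraicGeometry.Modules.IsoOfSectionsOnBasis
import Mathlib.AlgebraicGeometry.Noetherian
import HarnessLib

/-!
# [OURS · L1 W4.5b · T-DIRLIFT-UP route C, assembly glue] The special fibre of the carrier over the model square; the special fibre is
# locally Noetherian; frames and monomorphy of the cocycle line bundle of a line of sections

Cell res-hironaka, LADDER-RESOLUTION rung L, slot W4.5(b), crux chain w45b (EL♮(3) = stmt-ResolutionOfSingularities-20148); object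
T-DIRLIFT-UP (res-L1-w45b-plan-1 RULING 19:14:55Z, route C): the glue between C1c (`exists_directionSections`), C1b
(`exists_subLineBundle_of_proportional`) and T-P1VB (`exists_subLineBundle_lift_projectiveLine`).
`--supports stmt-ResolutionOfSingularities-20148 --as helper`. THEOREMS ONLY; def-free; NOT a statement of any manuscript; AI-written,
AI review weaker than expert review.

WHAT.
* `exists_iso_comap_of_modelSquare` (G1): in the model square `G₀ = X₀ ×_{Spec O} Spec k`, for `C = V(I) ≅ P` over `Spec O` and
  `P' = P ×_O k` (for `P = ℙ¹_O`: the tree's `isPullback_projMap'`), the trace `V(I·𝒪_{G₀})` is `P'`, compatibly: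
  `ψ ≫ ι ≫ j₀ = g ≫ e⁻¹ ≫ ι_C` (pasting of cartesian squares) — the `ψ` input of C1c.
* `isClosedImmersion_of_modelSquare`, `isLocallyNoetherian_of_modelSquare` (G2): `j₀` is a closed immersion (base change of
  `Spec k → Spec O`, `O → k` onto), so `G₀` is locally Noetherian with `X₀`.
* `exists_frame_lineBundle` (G3): the cocycle line bundle has rank-one frames `𝒪 ≅ L|_{U_z}` (T-P1VB's `hL₀`).
* `mono_of_eval_one` (G5): C1b's `ι : L → G` (`ι|_{U_z} = (s ↦ s · w_z)`, `ρ_z(w_z) = 1`) is a monomorphism; with the tree's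
  `Literature.Algebra.Homology.shortExact_cokernel_of_mono` (`ExtModPowers.lean`) this gives T-P1VB's `(Q, π, w, hS)`.
-/

noncomputable section

open CategoryTheory CategoryTheory.Limits AlgebraicGeometry Opposite TopologicalSpace
open Literature.AlgebraicGeometry.Modules Literature.AlgebraicGeometry.Motives
open Literature.AlgebraicGeometry.Resolution

set_option linter.dupNamespace false -- mandated namespace `Summit.<Summit>.<Problem>` of this single-conjunct summit

namespace Summit.ResolutionOfSingularities.ResolutionOfSingularities.Cruxes.EquisingularLiftNat.P1VB

/-! ## G1. The special fibre of the rational carrier -/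

/-- **`V(I·𝒪_{G₀}) ≅ ℙ¹_k` over the model square.** `G₀ = X₀ ×_{Spec O} Spec k` (`hsq`), `e : V(I) ≅ P` over `Spec O` (`he`) for an
`O`-scheme `P` (e.g. `ℙ¹_O`) with base change square `P' = P ×_{Spec O} Spec k` (`hP`, e.g. the tree's `isPullback_projMap'` for
`ℙ¹_k → ℙ¹_O`): there is `ψ : P' ⟶ V(I·𝒪_{G₀})`, an isomorphism, with `ψ ≫ ι ≫ j₀ = g ≫ e⁻¹ ≫ ι_C`.
[cite: Liu2002, Prop. 3.1.9 and Ex. 3.1.10] [cite: GortzWedhorn2020, Prop. 4.20] -/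
theorem exists_iso_comap_of_modelSquare {O k : Type} [CommRing O] [CommRing k] (θ : O →+* k)
    {X₀ G₀ P P' : Scheme.{0}} (f₀ : X₀ ⟶ Spec (.of O)) (j₀ : G₀ ⟶ X₀) (t₀ : G₀ ⟶ Spec (.of k))
    (hsq : IsPullback j₀ t₀ f₀ (Spec.map (CommRingCat.ofHom θ)))
    (q : P ⟶ Spec (.of O)) (q' : P' ⟶ Spec (.of k)) (g : P' ⟶ P) (hP : IsPullback g q' q (Spec.map (CommRingCat.ofHom θ)))
    (I : X₀.IdealSheafData) (e : I.subscheme ≅ P) (he : e.hom ≫ q = I.subschemeι ≫ f₀) :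
    ∃ ψ : P' ⟶ (I.comap j₀).subscheme, IsIso ψ ∧ ψ ≫ (I.comap j₀).subschemeι ≫ j₀ = g ≫ e.inv ≫ I.subschemeι := by
  have he' : e.inv ≫ I.subschemeι ≫ f₀ = q := by
    rw [← he, e.inv_hom_id_assoc]
  -- the map to the special fibre
  have w : (g ≫ e.inv ≫ I.subschemeι) ≫ f₀ = q' ≫ Spec.map (CommRingCat.ofHom θ) := by
    rw [Category.assoc, Category.assoc, he']
    exact hP.w
  let ϖ : P' ⟶ G₀ := hsq.lift _ _ w
  have hϖ₁ : ϖ ≫ j₀ = g ≫ e.inv ≫ I.subschemeι := hsq.lift_fst _ _ w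
  have hϖ₂ : ϖ ≫ t₀ = q' := hsq.lift_snd _ _ w
  -- `P' = P ×_{X₀} G₀` by pasting
  have big : IsPullback (ϖ ≫ t₀) g (Spec.map (CommRingCat.ofHom θ)) ((e.inv ≫ I.subschemeι) ≫ f₀) := by
    rw [hϖ₂, Category.assoc, he']
    exact hP.flip
  have hcart : IsPullback ϖ g j₀ (e.inv ≫ I.subschemeι) := IsPullback.of_right big hϖ₁ hsq.flip
  -- replace `P` by `V(I)` along `e`
  have Q : IsPullback (g ≫ e.inv) ϖ I.subschemeι j₀ :=
    hcart.flip.of_iso (Iso.refl _) e.symm (Iso.refl _) (Iso.refl _) (by simp) (by simp) (by simp) (by simp)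
  have sJ := isPullback_subschemeMap j₀ I
  refine ⟨(Q.isoIsPullback _ _ sJ).hom, inferInstance, ?_⟩
  rw [← Category.assoc, Q.isoIsPullback_hom_snd _ _ sJ, hϖ₁]

/-! ## G2. The special fibre is a closed subscheme, locally Noetherian -/

/-- In the model square with `O → k` onto, `j₀ : G₀ → X₀` is a closed immersion. [cite: GortzWedhorn2020, Prop. 4.20] -/
theorem isClosedImmersion_of_modelSquare {O k : Type} [CommRing O] [CommRing k] (θ : O →+* k) (hθ : Function.Surjective θ)
    {X₀ G₀ : Scheme.{0}} (f₀ : X₀ ⟶ Spec (.of O)) (j₀ : G₀ ⟶ X₀) (t₀ : G₀ ⟶ Spec (.of k))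
    (hsq : IsPullback j₀ t₀ f₀ (Spec.map (CommRingCat.ofHom θ))) : IsClosedImmersion j₀ := by
  haveI : IsClosedImmersion (Spec.map (CommRingCat.ofHom θ)) := IsClosedImmersion.spec_of_surjective _ hθ
  exact MorphismProperty.of_isPullback hsq.flip inferInstance

/-- In the model square with `O → k` onto and `X₀` locally Noetherian, `G₀` is locally Noetherian. [folklore] -/
theorem isLocallyNoetherian_of_modelSquare {O k : Type} [CommRing O] [CommRing k] (θ : O →+* k) (hθ : Function.Surjective θ)
    {X₀ G₀ : Scheme.{0}} [IsLocallyNoetherian X₀] (f₀ : X₀ ⟶ Spec (.of O)) (j₀ : G₀ ⟶ X₀) (t₀ : G₀ ⟶ Spec (.of k))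
    (hsq : IsPullback j₀ t₀ f₀ (Spec.map (CommRingCat.ofHom θ))) : IsLocallyNoetherian G₀ := by
  haveI := isClosedImmersion_of_modelSquare θ hθ f₀ j₀ t₀ hsq
  exact LocallyOfFiniteType.isLocallyNoetherian j₀

/-! ## G3. Rank-one frames of the cocycle line bundle -/

/-- The cocycle line bundle has rank-one frames `𝒪 ≅ L|_{U_y}` indexed by `Fin 1` (T-P1VB's `hL₀` shape).
[cite: Hartshorne1977, II Ex. 1.22] -/
theorem exists_frame_lineBundle {Y : Scheme.{0}} (c : UnitCocycle Y) (y : Y) :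
    ∃ (W : Y.Opens) (_ : y ∈ W), Nonempty (SheafOfModules.free (Fin 1) ≅ (lineBundle c).over W) :=
  ⟨c.U y, c.mem y, ⟨eqToIso (SheafOfModules.freeFunctor_obj (R := Y.ringCatSheaf.over (c.U y)) (Fin 1)).symm ≪≫
    (SheafOfModules.freeFunctor (R := Y.ringCatSheaf.over (c.U y))).mapIso (Equiv.ofUnique (Fin 1) PUnit).toIso ≪≫
    eqToIso (SheafOfModules.freeFunctor_obj (R := Y.ringCatSheaf.over (c.U y)) PUnit) ≪≫ c.lineBundleFrame y⟩⟩

/-! ## G5. The embedding of a line of sections is a monomorphism -/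

/-- Components of the zero section vanish. [folklore] -/
theorem comp_zero_section {Y : Scheme.{0}} (c : UnitCocycle Y) (V : Y.Opens) (x : Y) : c.comp (0 : Γ(lineBundle c, V)) x = 0 := rfl

/-- **`ι : L → G`, `ι|_{U_z} = (s ↦ s · w_z)` with `ρ_z(w_z) = 1`, is a monomorphism**: a section killed by `ι` has all its components
zero (`s_z · w_z = 0 ⇒ s_z = ρ_z(s_z · w_z) = 0`). [cite: StacksProject, Tag 009U] -/
theorem mono_of_eval_one {Y : Scheme.{0}} (c : UnitCocycle Y) {G : Y.Modules} (w : ∀ z, Γ(G, c.U z)) (ι : lineBundle c ⟶ G)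
    (hι : ∀ z, (SheafOfModules.overFunctor _ (c.U z)).map ι = c.lineBundleTrivInv z ≫ smulSection (w z))
    (hρ : ∀ z, ∃ ρ : G.over (c.U z) ⟶ (unitModule Y).over (c.U z), @Eq Γ(Y, c.U z) (appLE ρ (𝟙 _) (w z)) 1) : Mono ι := by
  refine mono_of_injective_app_of_isAffineOpen _ fun V _ => ?_
  intro s t hst
  rw [← sub_eq_zero]
  have h0 : ι.app V (s - t) = 0 := by rw [map_sub, sub_eq_zero]; exact hst
  apply c.section_ext
  intro x
  rw [comp_zero_section]
  -- restrict to `W := V ⊓ U_x`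
  obtain ⟨ρ, hρx⟩ := hρ x
  let k : V ⊓ c.U x ⟶ c.U x := homOfLE inf_le_right
  have h1 : appLE ((SheafOfModules.overFunctor _ (c.U x)).map ι) k
      ((lineBundle c).presheaf.map (homOfLE (inf_le_left : V ⊓ c.U x ≤ V)).op (s - t)) = 0 := by
    rw [appLE_over_map]
    have hnat := PresheafOfModules.naturality_apply ι.val (homOfLE (inf_le_left : V ⊓ c.U x ≤ V)).op (s - t)
    change ι.app (V ⊓ c.U x) ((lineBundle c).presheaf.map (homOfLE (inf_le_left : V ⊓ c.U x ≤ V)).op (s - t)) = 0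
    change ι.app (V ⊓ c.U x) ((lineBundle c).presheaf.map (homOfLE (inf_le_left : V ⊓ c.U x ≤ V)).op (s - t)) =
      G.presheaf.map (homOfLE (inf_le_left : V ⊓ c.U x ≤ V)).op (ι.app V (s - t)) at hnat
    rw [hnat, h0, map_zero]
  rw [hι x, appLE_comp, UnitCocycle.appLE_lineBundleTrivInv, UnitCocycle.comp_map, secRes_secRes, appLE_smulSection] at h1
  -- apply `ρ_x`
  have h2 := congrArg (fun m => (appLE ρ k m : Γ(Y, V ⊓ c.U x))) h1
  simp only at h2
  rw [appLE_smul_right, appLE_zero_right] at h2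
  have h3 : @Eq Γ(Y, V ⊓ c.U x) (appLE ρ k (G.presheaf.map k.op (w x))) 1 := by
    have h := appLE_map ρ (𝟙 (c.U x)) k (w x)
    rw [Category.comp_id] at h
    have h' : @Eq Γ(Y, V ⊓ c.U x) (appLE ρ k (G.presheaf.map k.op (w x))) (Y.presheaf.map k.op (appLE ρ (𝟙 (c.U x)) (w x) : Γ(Y, c.U x))) := h
    rw [h', hρx, map_one]
  have h4 : ∀ (r : Γ(Y, V ⊓ c.U x)) (m : Γ(Y, V ⊓ c.U x)), @Eq Γ(Y, V ⊓ c.U x) (appLE ρ k (G.presheaf.map k.op (w x))) m →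
      (r • appLE ρ k (G.presheaf.map k.op (w x)) : Γ(unitModule Y, V ⊓ c.U x)) = r * m := by
    intro r m hm; rw [← hm]; rfl
  rw [h4 _ 1 h3, mul_one] at h2
  rw [← secRes_self (c.comp (s - t) x)]
  exact h2

end Summit.ResolutionOfSingularities.ResolutionOfSingularities.Cruxes.EquisingularLiftNat.P1VB

end
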